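import Summits.HodgeConjecture.HodgeConjecture.Theses.EndoscopicMiddleDegree
import Literature.AlgebraicGeometry.ShimuraVarieties.HeckeCorrespondenceAction
import Literature.AlgebraicGeometry.HodgeTheory.ComplexGysinCorrespondence
import Literature.AlgebraicGeometry.HodgeTheory.AnalyticSupport
import Literature.AlgebraicGeometry.HodgeTheory.GAGADimensionProofs
import Literature.AlgebraicGeometry.HodgeTheory.ComplexConjugationHolds
import Literature.AlgebraicTopology.SingularHomology.FiniteDeckTransferPullback
import Summits.HodgeConjecture.HodgeConjecture.Theorems.OrthogonalEnveloped.Negative.EnvelopeOfAlgebraic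

/-!
# Hecke graphs are algebraic via Chow / analytic support — the composition, with the four
# topological / analytic inputs as explicit hypotheses (crux `EndoscopicMiddleDegree.OrthogonalEnveloped`,
# stmt-HodgeConjecture-14300; `--supports`; third lead lineage, seat c2, 2026-08-16)

WHAT IS PROVED (sorry-free). Every line of the crux chain on `OrthogonalEnveloped` consumes the shared
construction stub `stub_heckePushPull` (a smooth projective SCHEME structure on the Hecke level covers —
Riemann existence + GAGA, absent from the tree) only through
`heckeGraphAlgebraic : ∃ γ ∈ algebraicClasses (X ⊗ X) (2n), corrAction μ … γ = T_g`. This file proves that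
conclusion from four inputs NONE of which is an algebraization theorem, using that the tree already proves
"analytically supported classes in degree `2p` are algebraic" unconditionally
(`IsAnalyticallySupported.mem_algebraicClasses` with `chow_analyticSet_analytification_holds` and
`gaga_le_coheight_of_regularLocus_codim_holds`):

* `exists_heckeGraphMap` — the TOPOLOGICAL Hecke graph `F_g = (π, π_g) : N_g \ 𝔹 → (X ⊗ X)(ℂ)` of an admissible `g`
  (`levelProj`, `twist`, `AlgPoints.prodEquiv`), with `pr₁ ∘ F_g = π`, `pr₂ ∘ F_g = π_g`;
* `exists_algebraic_corrAction_eq_hecke_of_inputs`, `heckeGraphAlgebraic_of_inputs` — GIVEN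
  (S0) the transfer of a homology class through a finite deck cover (`p_*(y ⌢ θ) = τ^* y ⌢ ξ`),
  (T3) the push–pull formula for the action of `D⁻¹(F_* θ)` through `corrAction μ`,
  (S2a) the vanishing of `D⁻¹(F_* θ)` off the image of `F`, and
  (S2b) the analyticity (codimension `≥ dim X` at regular points) of the image of `F_g` in a Hodge model of
  `X ⊗ X`,
  the class `γ_g := [Γ ∩ g⁻¹Γg : N_g]⁻¹ • D_{X⊗X}⁻¹(F_{g*} θ)` is ALGEBRAIC and acts as `T_g` exactly;
* companion file `…HeckeGraphChowHodgeType`: the second use of `stub_heckePushPull` (Hecke operators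
  preserve Hodge types) GRANTED the named fact `Grothendieck1969_supportedClasses_le_hodgeConiveau`.

(S0), (T3), (S2a) are LANDED stubs of the crux (p106716, p107091, p106705); (S2b) is the one
residual construction (proper discontinuity + freeness of `Γ` on the ball, chart plumbing). The crux
workfile `Cruxes/OrthogonalEnveloped/HeckeGraphChow.lean` is this file with the four inputs as `sorry`d stubs.

References: BMM arXiv:1306.1515 Part 2 §1.8, Thm. 61; Serre GAGA §19 Prop. 13; Fulton §16.1; Hatcher §3.G, §3.3.
-/

noncomputable section

-- The mandated namespace `Summit.<P>.<Sub>.Theorems.…` repeats `HodgeConjecture` (single-conjunct summit).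
set_option linter.dupNamespace false

namespace Summit.HodgeConjecture.HodgeConjecture.Theorems.EndoscopicMiddleDegreeOrthogonalEnvelopedHeckeGraphChow

open scoped BigOperators Manifold
open CategoryTheory MonoidalCategory CartesianMonoidalCategory
open Literature.AlgebraicGeometry.Motives (SchemeOver ComplexPoints IsSmoothProjective AlgPoints)
open Literature.AlgebraicGeometry.Motives (IsSmoothProjective.tensor_holds)
open Literature.AlgebraicGeometry.HodgeTheory
open Literature.AlgebraicGeometry.ShimuraVarieties
open Literature.AlgebraicTopology.SingularHomology
open Literature.Geometry.Kaehler (IsAnalyticSet regularLocus IsRegularPointOfCodim)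
open Summit.HodgeConjecture.HodgeConjecture.Theorems.OrthogonalEnveloped.Negative.EnvelopeOfAlgebraic
  (two_add_two)

/-! ## Degree bookkeeping -/

/-- `2·2(m+1) + 2·2(m+1) = 2(2(m+1) + 2(m+1))`: the degree of the Hecke graph class as a codegree
of the fundamental class of `(X ⊗ X)(ℂ)`. [folklore] -/
theorem four_add_four (m : ℕ) :
    2 * (2 * (m + 1)) + 2 * (2 * (m + 1)) = 2 * (2 * (m + 1) + 2 * (m + 1)) := by ring

/-! ## The topological Hecke graph -/

variable {m : ℕ} {X : SchemeOver ℂ}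

/-- The **topological Hecke graph** `F_g : N_g \ 𝔹 → (X ⊗ X)(ℂ)`, `ℓ ↦ (π ℓ, π_g ℓ)` of an admissible
`g`, as a continuous map with `pr₁ ∘ F_g = π` (the level projection), `pr₂ ∘ F_g = π_g` (the twisted
projection) and the expected image (continuity: `levelProj`, `twist` are continuous and
`(X ⊗ X)(ℂ) ≃ₜ X(ℂ) × X(ℂ)` by `AlgPoints.prodEquiv`). [cite: Shimura1973, Ch. 7 §7.2] -/
theorem exists_heckeGraphMap (D : UnitaryBallQuotientDatum (2 * (m + 1)) X)
    {g : GL (Fin (2 * (m + 1) + 1)) D.E} (h : D.IsHeckeAdmissible g) :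
    ∃ F : C(D.LevelCover (D.heckeLevel g), ComplexPoints (X ⊗ X)),
      (AlgPoints.mapContinuous (L := ℂ) (fst X X)).comp F = D.levelProj (D.heckeLevel g) ∧
      (AlgPoints.mapContinuous (L := ℂ) (snd X X)).comp F =
        UnitaryBallQuotientDatum.IsHeckeAdmissible.twist D h ∧
      Set.range (fun ℓ : D.LevelCover (D.heckeLevel g) ↦
        (AlgPoints.prodEquiv (X := X) (Y := X) (L := ℂ)).symm
          (D.levelProj (D.heckeLevel g) ℓ, UnitaryBallQuotientDatum.IsHeckeAdmissible.twist D h ℓ)) =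
        Set.range F := by
  refine ⟨⟨fun ℓ ↦ (AlgPoints.prodEquiv (X := X) (Y := X) (L := ℂ)).symm
      (D.levelProj (D.heckeLevel g) ℓ, UnitaryBallQuotientDatum.IsHeckeAdmissible.twist D h ℓ),
    AlgPoints.continuous_prodEquiv_symm.comp
      ((D.levelProj (D.heckeLevel g)).continuous.prodMk
        (UnitaryBallQuotientDatum.IsHeckeAdmissible.twist D h).continuous)⟩, ?_, ?_, rfl⟩
  · refine ContinuousMap.ext fun ℓ ↦ ?_
    simp only [ContinuousMap.comp_apply, ContinuousMap.coe_mk, AlgPoints.mapContinuous_apply]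
    rw [← AlgPoints.prodEquiv_apply_fst, Equiv.apply_symm_apply]
  · refine ContinuousMap.ext fun ℓ ↦ ?_
    simp only [ContinuousMap.comp_apply, ContinuousMap.coe_mk, AlgPoints.mapContinuous_apply]
    rw [← AlgPoints.prodEquiv_apply_snd, Equiv.apply_symm_apply]

/-- **Non-admissible `g`: `T_g = 0 = P_0`.** [folklore] -/
theorem exists_algebraic_corrAction_eq_hecke_of_not (μ : OrientationFamily)
    (D : UnitaryBallQuotientDatum (2 * (m + 1)) X) {g : GL (Fin (2 * (m + 1) + 1)) D.E}
    (hg : ¬ D.IsHeckeAdmissible g) :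
    ∃ γ ∈ algebraicClasses (X ⊗ X) (2 * (m + 1)),
      corrAction μ D.isSmoothProjective D.isSmoothProjective
          (rfl : 2 * (m + 1) + 2 * (2 * (m + 1)) = 2 * (m + 1) + 2 * (2 * (m + 1))) γ =
        D.heckeCorrespondenceAction (2 * (m + 1)) g :=
  ⟨0, zero_mem _, by rw [map_zero, D.heckeCorrespondenceAction_of_not hg]⟩

/-! ## Analytic support from vanishing off the image -/

/-- **Transport of the vanishing to a Hodge model.** If a class `γ` on `Y(ℂ)` dies on the complement
of the image of `F : L → Y(ℂ)`, and that image read in a Hodge model `A` of `Y` is a closed analytic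
subset all of whose regular points have codimension `≥ p`, then `γ` is analytically supported in
codimension `≥ p` (restriction commutes with the comparison homeomorphism `A.toComplexPoints`).
[cite: VoisinHodgeI2002, §11.1.2] [cite: SerreGAGA1956, §19 Prop. 13] -/
theorem isAnalyticallySupported_of_vanishesOffImage {n : ℕ} {Y : SchemeOver ℂ} (A : HodgeModel n Y)
    {L : Type} [TopologicalSpace L] (F : C(L, ComplexPoints Y)) (p : ℕ) {k : ℕ}
    (γ : complexBetti Y k)
    (hS : IsAnalyticSet 𝓘(ℂ, A.model) (A.toComplexPoints ⁻¹' Set.range F) ∧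
      ∀ x ∈ regularLocus 𝓘(ℂ, A.model) (A.toComplexPoints ⁻¹' Set.range F),
        ∀ q : ℕ, IsRegularPointOfCodim 𝓘(ℂ, A.model) (A.toComplexPoints ⁻¹' Set.range F) q x → p ≤ q)
    (hvan : singularCohomology.map ℂ ℂ
      (⟨Subtype.val, continuous_subtype_val⟩ :
        C({P : ComplexPoints Y // P ∉ Set.range F}, ComplexPoints Y)) k γ = 0) :
    IsAnalyticallySupported A p γ := by
  refine ⟨A.toComplexPoints ⁻¹' Set.range F, hS, ?_⟩
  let ι : C({x : A.carrier // x ∉ A.toComplexPoints ⁻¹' Set.range F},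
      {P : ComplexPoints Y // P ∉ Set.range F}) :=
    ⟨fun x ↦ ⟨A.toComplexPoints x.1, x.2⟩,
      (A.isAnalytification.isHomeomorph.continuous.comp continuous_subtype_val).subtype_mk _⟩
  have hc : (⟨A.toComplexPoints, A.isAnalytification.isHomeomorph.continuous⟩ :
        C(A.carrier, ComplexPoints Y)).comp
      (⟨Subtype.val, continuous_subtype_val⟩ :
        C({x : A.carrier // x ∉ A.toComplexPoints ⁻¹' Set.range F}, A.carrier)) =
      (⟨Subtype.val, continuous_subtype_val⟩ :
        C({P : ComplexPoints Y // P ∉ Set.range F}, ComplexPoints Y)).comp ι :=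
    ContinuousMap.ext fun x ↦ rfl
  have e1 : singularCohomology.map ℂ ℂ
        (⟨Subtype.val, continuous_subtype_val⟩ :
          C({x : A.carrier // x ∉ A.toComplexPoints ⁻¹' Set.range F}, A.carrier)) k
        (A.pullback k γ) =
      singularCohomology.map ℂ ℂ ι k
        (singularCohomology.map ℂ ℂ
          (⟨Subtype.val, continuous_subtype_val⟩ :
            C({P : ComplexPoints Y // P ∉ Set.range F}, ComplexPoints Y)) k γ) := by
    rw [← ModuleCat.comp_apply, ← singularCohomology.map_comp, hc, singularCohomology.map_comp,
      ModuleCat.comp_apply]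
  rw [e1, hvan, map_zero]

/-! ## The four inputs, as section hypotheses

(S0) transfer of a homology class through a finite deck cover; (T3) push–pull for the action of
`D⁻¹(F_* θ)`; (S2a) vanishing of `D⁻¹(F_* θ)` off the image of `F`; (S2b) analyticity of the Hecke graph.
They are the registered stubs `stub_transferFundamentalClass` (LANDED p106716), `stub_topCorrAction`
(LANDED p107091), `stub_vanishesOffImage` (LANDED p106705), `stub_heckeGraphAnalytic` (open) of the crux,
byte-identical; taken as hypotheses here so that this file does not wait for the farm to serve the three
freshly landed modules. -/

section Inputs

variable
    (hS0 : ∀ {G : Type} [Group G] [Fintype G] {E B : Type} [TopologicalSpace E] [TopologicalSpace B]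
            [MulAction G E] (c : FiniteDeckCover G E B) {n : ℕ} (ξ : singularHomology ℂ ℂ B n),
            ∃ θ : singularHomology ℂ ℂ E n,
              ∀ (a b : ℕ) (hab : a + b = n) (y : singularCohomology ℂ ℂ E a),
                singularHomology.map ℂ ℂ c.proj b (capProduct hab y θ) =
                  capProduct hab (c.transferMap a y) ξ)
    (hT3 : ∀ (μ : OrientationFamily), μ.HasPoincareDuality →
            ∀ (m : ℕ) (X : SchemeOver ℂ) (hX : IsSmoothProjective (2 * (m + 1)) X)
              (L : Type) [TopologicalSpace L] (F : C(L, ComplexPoints (X ⊗ X)))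
              (θ : singularHomology ℂ ℂ L (2 * (2 * (m + 1))))
              (γ : complexBetti (X ⊗ X) (2 * (2 * (m + 1)))),
              capProduct (four_add_four m) γ (μ (IsSmoothProjective.tensor_holds hX hX)).fundamentalClass =
                singularHomology.map ℂ ℂ F (2 * (2 * (m + 1))) θ →
              ∀ β : complexBetti X (2 * (m + 1)),
                capProduct (two_add_two m)
                    (corrAction μ hX hX
                      (rfl : 2 * (m + 1) + 2 * (2 * (m + 1)) = 2 * (m + 1) + 2 * (2 * (m + 1))) γ β)
                    (μ hX).fundamentalClass =
                  singularHomology.map ℂ ℂ ((AlgPoints.mapContinuous (L := ℂ) (fst X X)).comp F)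
                    (2 * (m + 1))
                    (capProduct (two_add_two m)
                      (singularCohomology.map ℂ ℂ ((AlgPoints.mapContinuous (L := ℂ) (snd X X)).comp F)
                        (2 * (m + 1)) β) θ))
    (hS2a : ∀ (μ : OrientationFamily), μ.HasPoincareDuality →
            ∀ (n : ℕ) (Y : SchemeOver ℂ) (hY : IsSmoothProjective n Y)
              (L : Type) [TopologicalSpace L] (F : C(L, ComplexPoints Y))
              (b q : ℕ) (hb : b + q = 2 * n) (θ : singularHomology ℂ ℂ L q) (γ : complexBetti Y b),
              capProduct hb γ (μ hY).fundamentalClass = singularHomology.map ℂ ℂ F q θ →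
              singularCohomology.map ℂ ℂ
                (⟨Subtype.val, continuous_subtype_val⟩ :
                  C({P : ComplexPoints Y // P ∉ Set.range F}, ComplexPoints Y)) b γ = 0)
    (hS2b : ∀ (m : ℕ) (X : SchemeOver ℂ) (D : UnitaryBallQuotientDatum (2 * (m + 1)) X), 1 ≤ m → m ≤ 2 →
            ∀ (g : GL (Fin (2 * (m + 1) + 1)) D.E) (h : D.IsHeckeAdmissible g)
              (A : HodgeModel (2 * (m + 1) + 2 * (m + 1)) (X ⊗ X)),
              IsAnalyticSet 𝓘(ℂ, A.model)
                  (A.toComplexPoints ⁻¹' Set.range (fun ℓ : D.LevelCover (D.heckeLevel g) ↦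
                    (AlgPoints.prodEquiv (X := X) (Y := X) (L := ℂ)).symm
                      (D.levelProj (D.heckeLevel g) ℓ, UnitaryBallQuotientDatum.IsHeckeAdmissible.twist D h ℓ))) ∧
                ∀ x ∈ regularLocus 𝓘(ℂ, A.model)
                    (A.toComplexPoints ⁻¹' Set.range (fun ℓ : D.LevelCover (D.heckeLevel g) ↦
                      (AlgPoints.prodEquiv (X := X) (Y := X) (L := ℂ)).symm
                        (D.levelProj (D.heckeLevel g) ℓ, UnitaryBallQuotientDatum.IsHeckeAdmissible.twist D h ℓ))),
                  ∀ q : ℕ, IsRegularPointOfCodim 𝓘(ℂ, A.model)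
                    (A.toComplexPoints ⁻¹' Set.range (fun ℓ : D.LevelCover (D.heckeLevel g) ↦
                      (AlgPoints.prodEquiv (X := X) (Y := X) (L := ℂ)).symm
                        (D.levelProj (D.heckeLevel g) ℓ, UnitaryBallQuotientDatum.IsHeckeAdmissible.twist D h ℓ))) q x →
                    2 * (m + 1) ≤ q)

include hS0 hT3 hS2a hS2b

/-! ## The composition: `heckeGraphAlgebraic` from the four inputs -/

/-- **The Hecke graph class and its action (admissible `g`)**: with `θ` the transfer of `[X(ℂ)]_μ`
(input S0) and `γ_g := D_{X⊗X}⁻¹(F_{g*} θ)`, the crux's correspondence action of `γ_g` is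
`τ ∘ π_g^*` EXACTLY (inputs T3 + S0 + injectivity of `D_X`), and `γ_g` is algebraic (inputs S2a + S2b:
analytically supported in codimension `2(m+1)`, then Chow + GAGA, both PROVED in the tree). Hence
`T_g = [Γ ∩ g⁻¹Γg : N_g]⁻¹ • τ ∘ π_g^*` is the action of the algebraic class `[Γ':N_g]⁻¹ • γ_g`.
[cite: BergeronMillsonMoeglin2016Balls, Part 2 §1.8 and Thm. 61] [cite: SerreGAGA1956, §19 Prop. 13] -/
theorem exists_algebraic_corrAction_eq_hecke_of_inputs {μ : OrientationFamily}
    (hμ : μ.HasPoincareDuality) (D : UnitaryBallQuotientDatum (2 * (m + 1)) X) (hm1 : 1 ≤ m)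
    (hm2 : m ≤ 2) {g : GL (Fin (2 * (m + 1) + 1)) D.E} (h : D.IsHeckeAdmissible g) :
    ∃ γ ∈ algebraicClasses (X ⊗ X) (2 * (m + 1)),
      corrAction μ D.isSmoothProjective D.isSmoothProjective
          (rfl : 2 * (m + 1) + 2 * (2 * (m + 1)) = 2 * (m + 1) + 2 * (2 * (m + 1))) γ =
        D.heckeCorrespondenceAction (2 * (m + 1)) g := by
  classical
  haveI : (D.heckeLevel g).FiniteIndex := h.finiteIndex
  letI : Fintype (↥D.Γ ⧸ D.heckeLevel g) := Subgroup.fintypeQuotientOfFiniteIndex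
  have hX := D.isSmoothProjective
  have hY := IsSmoothProjective.tensor_holds hX hX
  -- S0: the transfer `θ` of the fundamental class of `X(ℂ)` to the level cover
  obtain ⟨θ, hθ⟩ := hS0
    (UnitaryBallQuotientDatum.IsHeckeAdmissible.deckCover D h) (μ hX).fundamentalClass
  -- the topological Hecke graph `F` (kept opaque) and its two projections
  obtain ⟨F, hfst, hsnd, hrange⟩ := exists_heckeGraphMap D h
  -- the graph class `γ₀ := D_Y⁻¹ (F_* θ)` (kept opaque: only `γ₀ ⌢ [Y] = F_* θ` is used)
  obtain ⟨γ₀, hcap⟩ : ∃ γ₀ : complexBetti (X ⊗ X) (2 * (2 * (m + 1))),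
      capProduct (four_add_four m) γ₀ (μ hY).fundamentalClass =
        singularHomology.map ℂ ℂ F (2 * (2 * (m + 1))) θ :=
    ⟨poincareDualityInv (μ hY) (four_add_four m) (singularHomology.map ℂ ℂ F (2 * (2 * (m + 1))) θ), by
      rw [← poincareDualityMap_apply, poincareDualityMap_poincareDualityInv (hμ hY (four_add_four m))]⟩
  -- T3 + S0: the action of `γ₀` is `τ ∘ π_g^*`
  have hact : ∀ β, corrAction μ hX hX
      (rfl : 2 * (m + 1) + 2 * (2 * (m + 1)) = 2 * (m + 1) + 2 * (2 * (m + 1))) γ₀ β =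
      (UnitaryBallQuotientDatum.IsHeckeAdmissible.deckCover D h).transferMap (R := ℂ) (2 * (m + 1))
        (singularCohomology.map ℂ ℂ (UnitaryBallQuotientDatum.IsHeckeAdmissible.twist D h)
          (2 * (m + 1)) β) := by
    intro β
    refine (hμ hX (two_add_two m)).1 ?_
    have key := hT3 μ hμ m X hX (D.LevelCover (D.heckeLevel g)) F θ γ₀ hcap β
    rw [hfst, hsnd] at key
    rw [poincareDualityMap_apply, poincareDualityMap_apply, key]
    exact hθ _ _ (two_add_two m) _
  -- S2a + S2b: `γ₀` is analytically supported in codimension `2(m+1)`, hence algebraic (Chow + GAGA)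
  have halg : γ₀ ∈ algebraicClasses (X ⊗ X) (2 * (m + 1)) := by
    obtain ⟨A⟩ := nonempty_hodgeModel_holds.nonempty hY
    have hS := hS2b m X D hm1 hm2 g h A
    rw [hrange] at hS
    exact IsAnalyticallySupported.mem_algebraicClasses gaga_le_coheight_of_regularLocus_codim_holds hY
      (isAnalyticallySupported_of_vanishesOffImage A F (2 * (m + 1)) γ₀ hS
        (hS2a μ hμ _ (X ⊗ X) hY (D.LevelCover (D.heckeLevel g)) F
          (2 * (2 * (m + 1))) (2 * (2 * (m + 1))) (four_add_four m) θ γ₀ hcap))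
  -- conclusion: `T_g = [Γ' : N_g]⁻¹ • τ ∘ π_g^*` is the action of `[Γ' : N_g]⁻¹ • γ₀`
  refine ⟨((D.heckeIndex g : ℂ)⁻¹) • γ₀, Submodule.smul_mem _ _ halg, LinearMap.ext fun β ↦ ?_⟩
  rw [D.heckeCorrespondenceAction_apply h]
  dsimp only
  rw [map_smul, LinearMap.smul_apply, hact β]

/-- **Hecke operators are actions of algebraic self-correspondences — via Chow, without algebraizing
the level covers.** Byte-identical conclusion with the derived theorem `heckeGraphAlgebraic` of lines
`purity-sorted-hecke-envelope` / `hodge-tate-legible-envelope` (there from `stub_heckePushPull`); here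
from the four inputs S0, T3, S2a, S2b as hypotheses. [cite: BergeronMillsonMoeglin2016Balls, Part 2 §1.8 and Thm. 61]
[cite: SerreGAGA1956, §19 Prop. 13] -/
theorem heckeGraphAlgebraic_of_inputs :
    ∀ (μ : OrientationFamily), μ.HasPoincareDuality →
      ∀ (m : ℕ) (X : SchemeOver ℂ) (D : UnitaryBallQuotientDatum (2 * (m + 1)) X), 1 ≤ m → m ≤ 2 →
        ∀ g : GL (Fin (2 * (m + 1) + 1)) D.E,
          ∃ γ ∈ algebraicClasses (X ⊗ X) (2 * (m + 1)),
            corrAction μ D.isSmoothProjective D.isSmoothProjective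
                (rfl : 2 * (m + 1) + 2 * (2 * (m + 1)) = 2 * (m + 1) + 2 * (2 * (m + 1))) γ =
              D.heckeCorrespondenceAction (2 * (m + 1)) g := by
  intro μ hμ m X D hm1 hm2 g
  by_cases hadm : D.IsHeckeAdmissible g
  · exact exists_algebraic_corrAction_eq_hecke_of_inputs hS0 hT3 hS2a hS2b hμ D hm1 hm2 hadm
  · exact exists_algebraic_corrAction_eq_hecke_of_not μ D hadm

end Inputs

/-! ## The registered reduction: `heckeGraphAlgebraic` ⟸ the four topological / analytic inputs -/

/-- **REGISTERED STUB `stub_heckeGraphAlgebraicOfInputs` of the crux (seat c2): the Hecke operators are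
actions of ALGEBRAIC self-correspondences GIVEN the four inputs S0, T3, S2a (all three LANDED: p106716,
p107091, p106705) and S2b (analyticity of the Hecke graph, open)** — the construction stub
`stub_heckePushPull` of the crux chain reduced, through Chow + GAGA (proved in the tree), to pure topology
plus ONE analytic input. [cite: BergeronMillsonMoeglin2016Balls, Part 2 §1.8 and Thm. 61]
[cite: SerreGAGA1956, §19 Prop. 13] -/
theorem stub_heckeGraphAlgebraicOfInputs :
    (∀ {G : Type} [Group G] [Fintype G] {E B : Type} [TopologicalSpace E] [TopologicalSpace B]
          [MulAction G E] (c : FiniteDeckCover G E B) {n : ℕ} (ξ : singularHomology ℂ ℂ B n),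
          ∃ θ : singularHomology ℂ ℂ E n,
            ∀ (a b : ℕ) (hab : a + b = n) (y : singularCohomology ℂ ℂ E a),
              singularHomology.map ℂ ℂ c.proj b (capProduct hab y θ) =
                capProduct hab (c.transferMap a y) ξ) →
    (∀ (μ : OrientationFamily), μ.HasPoincareDuality →
          ∀ (m : ℕ) (X : SchemeOver ℂ) (hX : IsSmoothProjective (2 * (m + 1)) X)
            (L : Type) [TopologicalSpace L] (F : C(L, ComplexPoints (X ⊗ X)))
            (θ : singularHomology ℂ ℂ L (2 * (2 * (m + 1))))
            (γ : complexBetti (X ⊗ X) (2 * (2 * (m + 1)))),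
            capProduct (four_add_four m) γ (μ (IsSmoothProjective.tensor_holds hX hX)).fundamentalClass =
              singularHomology.map ℂ ℂ F (2 * (2 * (m + 1))) θ →
            ∀ β : complexBetti X (2 * (m + 1)),
              capProduct (two_add_two m)
                  (corrAction μ hX hX
                    (rfl : 2 * (m + 1) + 2 * (2 * (m + 1)) = 2 * (m + 1) + 2 * (2 * (m + 1))) γ β)
                  (μ hX).fundamentalClass =
                singularHomology.map ℂ ℂ ((AlgPoints.mapContinuous (L := ℂ) (fst X X)).comp F)
                  (2 * (m + 1))
                  (capProduct (two_add_two m)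
                    (singularCohomology.map ℂ ℂ ((AlgPoints.mapContinuous (L := ℂ) (snd X X)).comp F)
                      (2 * (m + 1)) β) θ)) →
    (∀ (μ : OrientationFamily), μ.HasPoincareDuality →
          ∀ (n : ℕ) (Y : SchemeOver ℂ) (hY : IsSmoothProjective n Y)
            (L : Type) [TopologicalSpace L] (F : C(L, ComplexPoints Y))
            (b q : ℕ) (hb : b + q = 2 * n) (θ : singularHomology ℂ ℂ L q) (γ : complexBetti Y b),
            capProduct hb γ (μ hY).fundamentalClass = singularHomology.map ℂ ℂ F q θ →
            singularCohomology.map ℂ ℂ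
              (⟨Subtype.val, continuous_subtype_val⟩ :
                C({P : ComplexPoints Y // P ∉ Set.range F}, ComplexPoints Y)) b γ = 0) →
    (∀ (m : ℕ) (X : SchemeOver ℂ) (D : UnitaryBallQuotientDatum (2 * (m + 1)) X), 1 ≤ m → m ≤ 2 →
          ∀ (g : GL (Fin (2 * (m + 1) + 1)) D.E) (h : D.IsHeckeAdmissible g)
            (A : HodgeModel (2 * (m + 1) + 2 * (m + 1)) (X ⊗ X)),
            IsAnalyticSet 𝓘(ℂ, A.model)
                (A.toComplexPoints ⁻¹' Set.range (fun ℓ : D.LevelCover (D.heckeLevel g) ↦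
                  (AlgPoints.prodEquiv (X := X) (Y := X) (L := ℂ)).symm
                    (D.levelProj (D.heckeLevel g) ℓ, UnitaryBallQuotientDatum.IsHeckeAdmissible.twist D h ℓ))) ∧
              ∀ x ∈ regularLocus 𝓘(ℂ, A.model)
                  (A.toComplexPoints ⁻¹' Set.range (fun ℓ : D.LevelCover (D.heckeLevel g) ↦
                    (AlgPoints.prodEquiv (X := X) (Y := X) (L := ℂ)).symm
                      (D.levelProj (D.heckeLevel g) ℓ, UnitaryBallQuotientDatum.IsHeckeAdmissible.twist D h ℓ))),
                ∀ q : ℕ, IsRegularPointOfCodim 𝓘(ℂ, A.model)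
                  (A.toComplexPoints ⁻¹' Set.range (fun ℓ : D.LevelCover (D.heckeLevel g) ↦
                    (AlgPoints.prodEquiv (X := X) (Y := X) (L := ℂ)).symm
                      (D.levelProj (D.heckeLevel g) ℓ, UnitaryBallQuotientDatum.IsHeckeAdmissible.twist D h ℓ))) q x →
                  2 * (m + 1) ≤ q) →
    ∀ (μ : OrientationFamily), μ.HasPoincareDuality →
      ∀ (m : ℕ) (X : SchemeOver ℂ) (D : UnitaryBallQuotientDatum (2 * (m + 1)) X), 1 ≤ m → m ≤ 2 →
        ∀ g : GL (Fin (2 * (m + 1) + 1)) D.E,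
          ∃ γ ∈ algebraicClasses (X ⊗ X) (2 * (m + 1)),
            corrAction μ D.isSmoothProjective D.isSmoothProjective
                (rfl : 2 * (m + 1) + 2 * (2 * (m + 1)) = 2 * (m + 1) + 2 * (2 * (m + 1))) γ =
              D.heckeCorrespondenceAction (2 * (m + 1)) g :=
  fun hS0 hT3 hS2a hS2b ↦ heckeGraphAlgebraic_of_inputs hS0 hT3 hS2a hS2b

end Summit.HodgeConjecture.HodgeConjecture.Theorems.EndoscopicMiddleDegreeOrthogonalEnvelopedHeckeGraphChow

end
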